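import Summits.QuantumFields.YangMills.Theorems.BalabanUVNodesN07FarRowsOfTowerLetters
import Summits.QuantumFields.YangMills.Theorems.BalabanUVNodesN07HalvingStepTopOfLocalLetters
import Literature.MathematicalPhysics.QuantumFieldTheory.Balaban1983to89.T4Continuum
import HarnessLib

/-!
# N07 [B11] (= [15] = [Balaban1985Variational]) Sect. F, S6 — **THE CHART's (154)–(159) ASSEMBLY AT ONE DATUM, MODULO TWO NAMED LETTERS** (part 1 of MODULE 82; part 2
# `…N07ChartMeetNorm77OfLetters` lifts it to HCHART-MEET-NORM-77 verbatim): at a datum of level `k ≥ 1` of the cube tower with print's (150) family `D″ = cubeDomains ⊓ D₂`, given any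
# componentwise `H_V`, the S3 row (T2) and TWO DISPLAYED LETTERS — (c′) the near rows of the block averages `‖(Q_{j(c)}A)(c)‖ ≤ β_N` on MODULE 77's near class, (d′) the (158) letters
# `Letters10On` of `A₁ := A − H_V(𝟙_reach·QA)` —: the chart's `∃ x_c B B′ A₁` with centred near rows (160), LEVEL-WEIGHTED far rows ((152)∕(156)–(157), MODULE 78), `B′ = 0`, and
# `A = A₁ + H_V B − H_V B′`

Cell `pub-ymgap`, seat `pub-ymgap-dag-n07-e` g26 (FAN-OUT §N07 row s3; LANE OWNER of the K0 road), MODULE 82a (INTENT-82, cell bus).  `--kind proof --supports stmt-QuantumFields-20541 --as helper`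
(K0⁷); count-neutral; def-free; `P := F.P K` of a `T4Family`, ANY second family `D₂`, any corner `a`, side `M`, collar `ρ ≥ L`.  [15] = [Balaban1985Variational]; [6] = [Balaban1985RegularSpaces];
[4] = [Balaban1984PropagatorsII]; [I] = [Balaban1987RG1].

THE ASSEMBLY (print pp. 302–303, in the tree's units).  Print splits the chart datum as `B − B′ = QA` with `B` the data of the averaged Landau copy ((154)–(155), δ-small near the box,
(160)) and `B′` the (156) second-order remainder; the `H`-door (161)∕(164) charges `‖B‖` and `‖B′‖` ADDITIVELY, so the tree may take `B := 𝟙_reach·QA`, `B′ := 0` and ask the near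
row of `QA` itself (δ-linear + ε² is budgetable through the knit's `C` and `Q` letters): `reach c :↔` «every fine site of the two end blocks of `c` lies under `□₀`» (all cells of level
`≥ 1`, MODULE 78 §2; the fine cells under `□₀`; near cells are in reach); `B c := 𝟙_reach(c)·bondAvgIter j(c) A c`; `B′ := 0`; `A₁ := A − H_V B`.  Rows: near ← (c′) (uniform ⇒ centred,
`dist + 1 ≥ 1`); far ← MODULE 78 `norm_bondAvgIter_le_of_tower152_meet_weighted` (`κ·L·ε·L^{k−j(c)} ≤ κ·L·ε·(ρ + M)·L^{k−j(c)}`), the fine cells under `□₀` by (T2) at `j′ = 0`, `0`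
beyond reach (the far PINNED cells beyond `□₀`, where MODULE 76 says `H`'s kernel vanishes on the print box — used by (d′)'s supplier, not here); `B′` trivially; `A₁` ← (d′); the split
identity by `map_zero`.  The near rows of `QA` ((c′)) are the (c′) pen's item: MODULE 80's rows of `log 𝒜_{j(c)}(U^u)(c)` (δ-linear) + print's (156) linearisation
(`log 𝒜_j(e^{iη_kA}) = i·L^{j−k}·Q_jA + O(A²)`), plan g91 WORD (n07-w6 lineage).

WHAT IS PROVED (sorry-free; no definition; axioms standard).  `reach_of_one_le`, `reach_of_near` (near ⇒ reach, incl. the fine dent cells of a level-1 datum), ★★ `chartRows_at_datum` (statement in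
the header; far coefficient `κ·L·ε·(ρ + M)`).
HONEST SCOPE.  By-name assembly; (c′) `hQnear` and (d′) `hA1` are HYPOTHESES at the datum — displayed, NOT discharged; nothing of [15]∕[6]∕[4] ANALYSIS asserted beyond MODULE 78's bookkeeping;
K0⁷ ∕ K1⁹ NOT closed; N07 NOT discharged; counts unmoved (typed 28∕28 · discharged 8∕27 per the chair); one finite 𝕋⁴ programme at fixed ε — the route closes the conditional finite-𝕋⁴ rung
`BalabanLadder.UV` ONLY; the YM mass gap (Clay) is NOT proved by any of this; nothing continuum ∕ ℝ⁴ ∕ OS.  No `sorry`, no `def`, no `instance`, no `notation`.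

References: [15] (147)–(153) p. 301, (154)–(159) pp. 302–303, (160)–(161) p. 303, (164) p. 304; [6] (1.131) pp. 98–99; [4] (2.3) p. 224, (2.20) p. 226, (2.35) p. 228; [I] (0.4) p. 251.
-/

set_option autoImplicit false

noncomputable section
open scoped BigOperators Matrix.Norms.L2Operator

namespace Summit.QuantumFields.YangMills.BalabanUVNodes.N07ChartRowsAtDatum

open Literature.MathematicalPhysics.QuantumFieldTheory.Balaban1983to89
open Literature.MathematicalPhysics.QuantumFieldTheory.Balaban1983to89.Node00
open LatticeFieldCalculus (bondAvgIter)
open B15Eq112TorusCover (cover)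
open B14DomainGeom (Pt)
open B5Eq117TorusCarriers (Mk)
open B5Eq118OneStroke (iterBlockOf)
open B5Prop12FieldsLattice (distSite distSite_nonneg)
open B7Prop1Local (InBox)
open B8Eq131Cubes (sqLo sqHi box cube cube_anti)
open B6SectADomainsV1 (Domains)
open B6SectAOperatorsV1 (BondIdx)
open T4Continuum (T4Family)
open Summit.QuantumFields.YangMills.BalabanUVNodes.N07HalvingStepTopOfLocalLetters (Letters10On)
open Summit.QuantumFields.YangMills.BalabanUVNodes.N07FarRowsOfTowerLetters (norm_bondAvgIter_le_of_tower152_meet_weighted mem_image_cover_cube_pred_of_iterBlockOf_eq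
  exists_collar_labels_of_lamBond_meet)

variable (F : T4Family) (N : ℕ) [NeZero N]

/-! ## §1  Reach -/

/-- **Cells of level `≥ 1` are in reach of `□₀`**: every fine site of the two end blocks of a `Λ_j`-cell (`1 ≤ j`) of `cubeDomains ⊓ D₂` lies under `□_{j−1} ⊆ □₀` (MODULE 78 §2, `L ≤ ρ`).
[cite: Balaban1985RegularSpaces, (1.131) p.99; Balaban1984PropagatorsII, (2.3) p.224] -/
theorem reach_of_one_le {K : ℕ} {a : Pt (F.P K).d} {M ρ k : ℕ} {hk : k ≤ (F.P K).m + (F.P K).K} (hLρ : (F.P K).L ≤ ρ) (D₂ : Domains (F.P K))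
    (c : BondIdx (domainsMeet (cubeDomains (F.P K) a M ρ k hk) D₂)) (h1 : 1 ≤ (c.1.1 : ℕ)) :
    (∀ x : Site (F.P K) 0, (iterBlockOf (c.1.1 : ℕ) x = c.1.2.src ∨ iterBlockOf (c.1.1 : ℕ) x = c.1.2.tgt) →
          x ∈ cover (F.P K) '' cube (F.P K).L a M ρ k 0) := by
  have hjk : (c.1.1 : ℕ) ≤ k := by
    have h := c.1.1.2
    simp only [domainsMeet_k, cubeDomains_k] at h
    omega
  obtain ⟨s, s', hsrc, htgt, hs, hs'⟩ := exists_collar_labels_of_lamBond_meet D₂ h1 hjk c.2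
  have hsub : cover (F.P K) '' cube (F.P K).L a M ρ k ((c.1.1 : ℕ) - 1) ⊆ cover (F.P K) '' cube (F.P K).L a M ρ k 0 :=
    Set.image_mono (cube_anti (Nat.zero_le _) (by omega))
  intro x hx
  rcases hx with hx | hx
  · exact hsub (mem_image_cover_cube_pred_of_iterBlockOf_eq (hjk.trans hk) hLρ h1 hjk hs (hx.trans hsrc))
  · exact hsub (mem_image_cover_cube_pred_of_iterBlockOf_eq (hjk.trans hk) hLρ h1 hjk hs' (hx.trans htgt))

/-- **Near cells are in reach**: a cell of the class «`j(c) = k`, or both end blocks in `□_{j(c)+1}^{(j(c)+1)}`» (`1 ≤ k`) has both end blocks under `□₀`: at level `≥ 1` by `reach_of_one_le`; a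
fine cell with both blocks in `□_1^{(1)}` because those blocks lie in `□₀` (MODULE 78 §2 at `j = 1`). [cite: Balaban1985Variational, (147)–(150) p.301; Balaban1985RegularSpaces, (1.131) p.99] -/
theorem reach_of_near {K : ℕ} {a : Pt (F.P K).d} {M ρ k : ℕ} {hk : k ≤ (F.P K).m + (F.P K).K} (hk1 : 1 ≤ k) (hLρ : (F.P K).L ≤ ρ) (D₂ : Domains (F.P K))
    (c : BondIdx (domainsMeet (cubeDomains (F.P K) a M ρ k hk) D₂)) (hnear : ((c.1.1 : ℕ) = k ∨ (blockOf c.1.2.src ∈ (cubeDomains (F.P K) a M ρ k hk).Om ((c.1.1 : ℕ) + 1) ∧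
        blockOf c.1.2.tgt ∈ (cubeDomains (F.P K) a M ρ k hk).Om ((c.1.1 : ℕ) + 1)))) :
    (∀ x : Site (F.P K) 0, (iterBlockOf (c.1.1 : ℕ) x = c.1.2.src ∨ iterBlockOf (c.1.1 : ℕ) x = c.1.2.tgt) →
          x ∈ cover (F.P K) '' cube (F.P K).L a M ρ k 0) := by
  by_cases h1 : 1 ≤ (c.1.1 : ℕ)
  · exact reach_of_one_le F hLρ D₂ c h1
  · -- a fine cell (`j(c) = 0`, so `1 ≤ k` rules out the top case): both blocks are labels of `□_1^{(1)}`
    have h0 : (c.1.1 : ℕ) = 0 := by omega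
    rcases hnear with htop | ⟨hs, ht⟩
    · exfalso; omega
    · obtain ⟨⟨⟨l, hl⟩, b⟩, hb⟩ := c
      simp only at h0 hs ht ⊢
      subst h0
      obtain ⟨t, htb, htc⟩ := (mem_cubeDomains_Om_iff le_rfl hk1 _).1 hs
      obtain ⟨t', htb', htc'⟩ := (mem_cubeDomains_Om_iff le_rfl hk1 _).1 ht
      have hcol : ∀ {q : Pt (F.P K).d}, InBox (sqLo (F.P K).L a ρ k 1) (sqHi (F.P K).L a M ρ k 1) q →
          InBox (sqLo (F.P K).L a ρ k 1 - 1) (sqHi (F.P K).L a M ρ k 1 + 1) q := fun hq i => by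
        obtain ⟨h₁, h₂⟩ := hq i
        simp only [Pi.sub_apply, Pi.add_apply, Pi.one_apply]
        constructor <;> linarith
      intro x hx
      have h11 : (1 : ℕ) - 1 = 0 := rfl
      rcases hx with hx | hx
      · have hx1 : iterBlockOf 1 x = coverAt (F.P K) 1 t := by
          show blockOf (iterBlockOf 0 x) = _; rw [hx]; exact htc.symm
        simpa [h11] using mem_image_cover_cube_pred_of_iterBlockOf_eq (a := a) (M := M) (ρ := ρ) (k := k) (hk1.trans hk) hLρ le_rfl hk1 (hcol htb) hx1
      · have hx1 : iterBlockOf 1 x = coverAt (F.P K) 1 t' := by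
          show blockOf (iterBlockOf 0 x) = _; rw [hx]; exact htc'.symm
        simpa [h11] using mem_image_cover_cube_pred_of_iterBlockOf_eq (a := a) (M := M) (ρ := ρ) (k := k) (hk1.trans hk) hLρ le_rfl hk1 (hcol htb') hx1

/-! ## §2  The per-datum assembly -/

omit [NeZero N] in
open scoped Classical in
/-- ★★ **THE PER-DATUM ASSEMBLY** (print's (154)–(159) at one datum of level `k ≥ 1`, in the tree's additive bookkeeping `B := 𝟙_reach·QA`, `B′ := 0`): given a componentwise `H_V`, the S3
row (T2) on the tower, `0 ≤ κ, ε`, a point `x₀` of the print box, and the two letters AT THIS DATUM — (c′) the near rows `‖(Q_{j(c)}A)(c)‖ ≤ β_N` on the near class, (d′) `Letters10On … t (A − H_V(𝟙_reach·QA))` —: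
`∃ x_c B B′ A₁` with the centred near rows (`β_N·(dist + 1)`), the weighted far rows (`κ·L·ε·(ρ + M)·L^{k−j(c)}`), `‖B′‖ ≤ s` (any `s ≥ 0`), `Letters10On … t A₁`, `A = A₁ + H_V B − H_V B′`.
[cite: Balaban1985Variational, (154)–(159) pp.302–303, (160)–(161) p.303, (164) p.304, (152) p.301; Balaban1984PropagatorsII, (2.20) p.226, (2.35) p.228] -/
theorem chartRows_at_datum {K : ℕ} {a : Pt (F.P K).d} {M ρ k : ℕ} {hk : k ≤ (F.P K).m + (F.P K).K} (hk1 : 1 ≤ k) (hLρ : (F.P K).L ≤ ρ) (hρ : 1 ≤ ρ) (D₂ : Domains (F.P K))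
    (A : PBond (F.P K) 0 → MatA N) {κ ε : ℝ} (hκ : 0 ≤ κ) (hε : 0 ≤ ε)
    (hAT : ∀ j', j' ≤ k → ∀ b ∈ (Sect2.regionOfSet (F.P K) (cover (F.P K) '' cube (F.P K).L a M ρ k j')).bonds, ‖A b‖ < κ * ε * ((F.P K).L : ℝ) ^ (k - j'))
    (HV : (BondIdx (domainsMeet (cubeDomains (F.P K) a M ρ k hk) D₂) → MatA N) →ₗ[ℂ] (PBond (F.P K) 0 → MatA N))
    {x₀ : Pt (F.P K).d} (hx₀ : x₀ ∈ box (F.P K).L a M k) {bN sB tA : ℝ} (hsB : 0 ≤ sB)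
    (hQnear : ∀ c : BondIdx (domainsMeet (cubeDomains (F.P K) a M ρ k hk) D₂), ((c.1.1 : ℕ) = k ∨ (blockOf c.1.2.src ∈ (cubeDomains (F.P K) a M ρ k hk).Om ((c.1.1 : ℕ) + 1) ∧
        blockOf c.1.2.tgt ∈ (cubeDomains (F.P K) a M ρ k hk).Om ((c.1.1 : ℕ) + 1))) → ‖bondAvgIter (c.1.1 : ℕ) A c.1.2‖ ≤ bN)
    (hA1 : Letters10On (cover (F.P K) '' box (F.P K).L a M k) ((F.P K).eta k) tA
      (fun b => A b - HV (fun c => if (∀ x : Site (F.P K) 0, (iterBlockOf (c.1.1 : ℕ) x = c.1.2.src ∨ iterBlockOf (c.1.1 : ℕ) x = c.1.2.tgt) →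
          x ∈ cover (F.P K) '' cube (F.P K).L a M ρ k 0) then bondAvgIter (c.1.1 : ℕ) A c.1.2 else 0) b)) :
    ∃ (xc : Pt (F.P K).d) (B B' : BondIdx (domainsMeet (cubeDomains (F.P K) a M ρ k hk) D₂) → MatA N) (A₁ : PBond (F.P K) 0 → MatA N),
      xc ∈ box (F.P K).L a M k ∧
      (∀ c : BondIdx (domainsMeet (cubeDomains (F.P K) a M ρ k hk) D₂), ((c.1.1 : ℕ) = k ∨ (blockOf c.1.2.src ∈ (cubeDomains (F.P K) a M ρ k hk).Om ((c.1.1 : ℕ) + 1) ∧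
        blockOf c.1.2.tgt ∈ (cubeDomains (F.P K) a M ρ k hk).Om ((c.1.1 : ℕ) + 1))) →
        ‖B c‖ ≤ bN * (distSite (Mk (F.P K) (c.1.1 : ℕ)) c.1.2.src (iterBlockOf (c.1.1 : ℕ) (cover (F.P K) xc)) + 1)) ∧
      (∀ c : BondIdx (domainsMeet (cubeDomains (F.P K) a M ρ k hk) D₂), ¬ ((c.1.1 : ℕ) = k ∨ (blockOf c.1.2.src ∈ (cubeDomains (F.P K) a M ρ k hk).Om ((c.1.1 : ℕ) + 1) ∧
        blockOf c.1.2.tgt ∈ (cubeDomains (F.P K) a M ρ k hk).Om ((c.1.1 : ℕ) + 1))) →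
        ‖B c‖ ≤ κ * ((F.P K).L : ℝ) * ε * ((ρ : ℝ) + (M : ℝ)) * ((F.P K).L : ℝ) ^ (k - (c.1.1 : ℕ))) ∧
      (∀ c, ‖B' c‖ ≤ sB) ∧
      Letters10On (cover (F.P K) '' box (F.P K).L a M k) ((F.P K).eta k) tA A₁ ∧
      (∀ b, A b = A₁ b + HV B b - HV B' b) := by
  -- the reach datum `𝟙_reach·QA`
  set Qr : BondIdx (domainsMeet (cubeDomains (F.P K) a M ρ k hk) D₂) → MatA N :=
    fun c => if (∀ x : Site (F.P K) 0, (iterBlockOf (c.1.1 : ℕ) x = c.1.2.src ∨ iterBlockOf (c.1.1 : ℕ) x = c.1.2.tgt) →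
          x ∈ cover (F.P K) '' cube (F.P K).L a M ρ k 0) then bondAvgIter (c.1.1 : ℕ) A c.1.2 else 0 with hQr
  refine ⟨x₀, Qr, fun _ => 0, fun b => A b - HV Qr b, hx₀, ?_, ?_, fun _ => by rw [norm_zero]; exact hsB, hA1, ?_⟩
  · -- the near rows: near ⇒ reach, (c′), and `dist + 1 ≥ 1`
    intro c hc
    have hreach : (∀ x : Site (F.P K) 0, (iterBlockOf (c.1.1 : ℕ) x = c.1.2.src ∨ iterBlockOf (c.1.1 : ℕ) x = c.1.2.tgt) →
          x ∈ cover (F.P K) '' cube (F.P K).L a M ρ k 0) := reach_of_near F hk1 hLρ D₂ c hc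
    have hQ : Qr c = bondAvgIter (c.1.1 : ℕ) A c.1.2 := by rw [hQr]; exact if_pos hreach
    rw [hQ]
    have h := hQnear c hc
    have hb0 : 0 ≤ bN := le_trans (norm_nonneg _) h
    have hd0 : (0 : ℝ) ≤ distSite (Mk (F.P K) (c.1.1 : ℕ)) c.1.2.src (iterBlockOf (c.1.1 : ℕ) (cover (F.P K) x₀)) := distSite_nonneg _ _
    calc _ ≤ bN := h
      _ = bN * 1 := (mul_one _).symm
      _ ≤ bN * (distSite (Mk (F.P K) (c.1.1 : ℕ)) c.1.2.src (iterBlockOf (c.1.1 : ℕ) (cover (F.P K) x₀)) + 1) := mul_le_mul_of_nonneg_left (by linarith) hb0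
  · -- the far rows: cells of level `≥ 1` by MODULE 78, fine cells under `□₀` by (T2) at `j′ = 0`, `0` beyond reach
    intro c hc
    have hρM : (1 : ℝ) ≤ (ρ : ℝ) + (M : ℝ) := by
      have : (1 : ℝ) ≤ (ρ : ℝ) := by exact_mod_cast hρ
      have : (0 : ℝ) ≤ (M : ℝ) := Nat.cast_nonneg _
      linarith
    have hL0 : (0 : ℝ) ≤ ((F.P K).L : ℝ) := Nat.cast_nonneg _
    have hL1 : (1 : ℝ) ≤ ((F.P K).L : ℝ) := by exact_mod_cast (F.P K).L_pos
    have hrhs0 : 0 ≤ κ * ((F.P K).L : ℝ) * ε * ((ρ : ℝ) + (M : ℝ)) * ((F.P K).L : ℝ) ^ (k - (c.1.1 : ℕ)) := by positivity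
    by_cases hreach : (∀ x : Site (F.P K) 0, (iterBlockOf (c.1.1 : ℕ) x = c.1.2.src ∨ iterBlockOf (c.1.1 : ℕ) x = c.1.2.tgt) →
          x ∈ cover (F.P K) '' cube (F.P K).L a M ρ k 0)
    · have hQ : Qr c = bondAvgIter (c.1.1 : ℕ) A c.1.2 := by rw [hQr]; exact if_pos hreach
      rw [hQ]
      by_cases h1 : 1 ≤ (c.1.1 : ℕ)
      · have h78 := norm_bondAvgIter_le_of_tower152_meet_weighted (P := F.P K) hLρ D₂ A hAT c h1
        calc _ ≤ κ * ((F.P K).L : ℝ) * ε * ((F.P K).L : ℝ) ^ (k - (c.1.1 : ℕ)) := h78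
          _ = κ * ((F.P K).L : ℝ) * ε * 1 * ((F.P K).L : ℝ) ^ (k - (c.1.1 : ℕ)) := by ring
          _ ≤ κ * ((F.P K).L : ℝ) * ε * ((ρ : ℝ) + (M : ℝ)) * ((F.P K).L : ℝ) ^ (k - (c.1.1 : ℕ)) := by
              apply mul_le_mul_of_nonneg_right _ (by positivity)
              exact mul_le_mul_of_nonneg_left hρM (by positivity)
      · -- a fine cell with both endpoints under `□₀`
        obtain ⟨⟨⟨l, hl⟩, b⟩, hb⟩ := c
        simp only at h1 hreach ⊢
        have h0 : l = 0 := by omega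
        subst h0
        have hsrc : b.src ∈ cover (F.P K) '' cube (F.P K).L a M ρ k 0 := hreach b.src (Or.inl rfl)
        have htgt : b.tgt ∈ cover (F.P K) '' cube (F.P K).L a M ρ k 0 := hreach b.tgt (Or.inr rfl)
        have h := (hAT 0 (Nat.zero_le _) b ⟨hsrc, htgt⟩).le
        rw [Nat.sub_zero] at h
        calc ‖bondAvgIter 0 A b‖ = ‖A b‖ := rfl
          _ ≤ κ * ε * ((F.P K).L : ℝ) ^ k := h
          _ = κ * 1 * ε * 1 * ((F.P K).L : ℝ) ^ (k - 0) := by rw [Nat.sub_zero]; ring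
          _ ≤ κ * ((F.P K).L : ℝ) * ε * ((ρ : ℝ) + (M : ℝ)) * ((F.P K).L : ℝ) ^ (k - 0) := by
              apply mul_le_mul_of_nonneg_right _ (by positivity)
              have := mul_le_mul (mul_le_mul_of_nonneg_left hL1 hκ) hρM zero_le_one (by positivity)
              nlinarith [mul_nonneg (mul_nonneg hκ hL0) hε]
    · have hQ : Qr c = 0 := by rw [hQr]; exact if_neg hreach
      rw [hQ, norm_zero]; exact hrhs0
  · -- the split identity: `A = A₁ + H_V B − H_V 0`
    intro b
    have h0 : HV (fun _ => (0 : MatA N)) b = 0 := by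
      have : (fun _ : BondIdx (domainsMeet (cubeDomains (F.P K) a M ρ k hk) D₂) => (0 : MatA N)) = 0 := rfl
      rw [this, map_zero]; rfl
    show A b = (A b - HV Qr b) + HV Qr b - HV (fun _ => (0 : MatA N)) b
    rw [h0]
    abel

end Summit.QuantumFields.YangMills.BalabanUVNodes.N07ChartRowsAtDatum

end
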